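import Summits.SmoothPoincare4.SmoothPoincare4.Theses.ConvexBisection
import Summits.SmoothPoincare4.SmoothPoincare4.Theorems.ConvexBisectionContractibleTwistedDoubleStandardHomotopySphere
import Summits.SmoothPoincare4.SmoothPoincare4.Statement
import HarnessLib

/-!
# `ContractibleTwistedDoubleStandard` — SPC4 implies the crux (unconditionally)

Crux stmt-SmoothPoincare4-3546 (`Summit.SmoothPoincare4.SmoothPoincare4.Theses.ConvexBisection.ContractibleTwistedDoubleStandard`,
route ConvexBisection): a closed smooth `4`-manifold which is a Stein bisection along a common contact
seam of two compact contractible Stein domains is `S⁴`.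

Sibling of `Negative/Spc4Sector.lean` (p115038).  With the LANDED homotopy-sphere lemma of line
`property-r-mazur-halves`
(`…Theorems.ContractibleTwistedDoubleStandard.PropertyRMazurHalves.stub_homotopySphere`, p112822: every crux
bisection `X` is homotopy equivalent to `S⁴` — seam diffeomorphism, collar gluing, van Kampen, Mayer–Vietoris,
Freedman–Quinn recognition) the implication SPC4 ⇒ crux is a one-liner, and with it:

* `crux_of_spc4` — `SmoothPoincare4 → ContractibleTwistedDoubleStandard` (registered helper stub of the crux item);
* `not_spc4_of_not_crux` — contrapositive: any counterexample to the crux is an exotic `S⁴`;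
* `nonSmallSector_of_spc4` — SPC4 ⇒ the residual stub `stub_nonSmallSector` of skeleton m11/m12 (registered
  helper stub), through `crux_of_spc4` and the weakening `Negative.nonSmallSector_of_crux` (re-proved inline
  here as a term, so that this file does not wait for the build of `Negative.Spc4Sector`).

Together with `Negative.oneOneTwoOneOne_of_spc4` (p115038: SPC4 ⇒ the bet) this certifies, sorry-free and
unconditionally, that the crux and BOTH open stubs of the line are sectors of SPC4: none overshoots the summit,
each is refutable only by an exotic `S⁴`.  No new mathematics: bookkeeping for the planners' promote-stub /
conjecture-item decisions (prepared by lead c6, landed by lead c7).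
-/

noncomputable section

set_option linter.dupNamespace false

open scoped Manifold ContDiff Topology ContinuousMap
open Set Function Literature.Topology.FourManifolds Literature.Geometry.Symplectic

namespace Summit.SmoothPoincare4.SmoothPoincare4.Theorems.ContractibleTwistedDoubleStandard.Negative

open Summit.SmoothPoincare4.SmoothPoincare4.Theses.ConvexBisection

/-- **SPC4 ⇒ the crux** (registered helper stub `crux_of_spc4`): a crux bisection `X` is a homotopy
`4`-sphere (`PropertyRMazurHalves.stub_homotopySphere`, p112822), so under `SmoothPoincare4` it is
diffeomorphic to `S⁴`. [folklore] -/
theorem crux_of_spc4 :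
    _root_.SmoothPoincare4 →
      Summit.SmoothPoincare4.SmoothPoincare4.Theses.ConvexBisection.ContractibleTwistedDoubleStandard :=
  fun h X _ _ _ _ _ _ W₁ _ _ _ _ _ W₂ _ _ _ _ _ J₁ J₂ e₁ e₂ h1 h2 hcov hL hR hC =>
    (PropertyRMazurHalves.stub_homotopySphere X W₁ W₂ J₁ J₂ e₁ e₂ h1 h2 hcov hL hR hC).elim
      fun hX => h X inferInstance inferInstance hX

/-- **¬ crux ⇒ ¬ SPC4**: any counterexample to `ContractibleTwistedDoubleStandard` is an exotic `S⁴`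
(contrapositive of `crux_of_spc4`). [folklore] -/
theorem not_spc4_of_not_crux :
    ¬ Summit.SmoothPoincare4.SmoothPoincare4.Theses.ConvexBisection.ContractibleTwistedDoubleStandard →
      ¬ _root_.SmoothPoincare4 :=
  fun hn h => hn (crux_of_spc4 h)

/-- **SPC4 ⇒ the residual stub** `stub_nonSmallSector` of line `property-r-mazur-halves` (registered
helper stub `nonSmallSector_of_spc4`; signature verbatim after the arrow): the residual is the crux with two
extra hypotheses (non-simply-connected seam, not both halves smoothly Mazur), which are dropped, and the crux
follows from SPC4 by `crux_of_spc4`. [folklore] -/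
theorem nonSmallSector_of_spc4 :
    _root_.SmoothPoincare4 →
    ∀ (X : Type) [TopologicalSpace X] [T2Space X] [SecondCountableTopology X] [CompactSpace X]
      [ChartedSpace (EuclideanSpace ℝ (Fin 4)) X] [IsManifold (𝓡 4) ∞ X]
      (W₁ : Type) [TopologicalSpace W₁] [ChartedSpace (EuclideanHalfSpace 4) W₁]
      [IsManifold (𝓡∂ 4) ∞ W₁] [CompactSpace W₁] [ContractibleSpace W₁]
      (W₂ : Type) [TopologicalSpace W₂] [ChartedSpace (EuclideanHalfSpace 4) W₂]
      [IsManifold (𝓡∂ 4) ∞ W₂] [CompactSpace W₂] [ContractibleSpace W₂]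
      (J₁ : SteinStructure W₁) (J₂ : SteinStructure W₂) (e₁ : W₁ → X) (e₂ : W₂ → X),
      Manifold.IsSmoothEmbedding (𝓡∂ 4) (𝓡 4) ∞ e₁ → Manifold.IsSmoothEmbedding (𝓡∂ 4) (𝓡 4) ∞ e₂ →
      Set.range e₁ ∪ Set.range e₂ = Set.univ →
      Set.range e₁ ∩ Set.range e₂ = e₁ '' (𝓡∂ 4).boundary W₁ →
      Set.range e₁ ∩ Set.range e₂ = e₂ '' (𝓡∂ 4).boundary W₂ →
      (∀ w₁ w₂, e₁ w₁ = e₂ w₂ →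
        Submodule.map (mfderiv (𝓡∂ 4) (𝓡 4) e₁ w₁).toLinearMap (contactPlane J₁.J w₁) =
          Submodule.map (mfderiv (𝓡∂ 4) (𝓡 4) e₂ w₂).toLinearMap (contactPlane J₂.J w₂)) →
      ¬ SimplyConnectedSpace ((𝓡∂ 4).boundary W₁) →
      ¬ ((∃ f : W₁ → ℝ, IsMorseAdapted (𝓡∂ 4) f ∧
            (∀ z, IsMCriticalPt (𝓡∂ 4) f z → morseIndex (𝓡∂ 4) f z ≤ 2) ∧
            (criticalSetOfIndex (𝓡∂ 4) f 0).ncard = 1 ∧ (criticalSetOfIndex (𝓡∂ 4) f 1).ncard = 1 ∧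
            (criticalSetOfIndex (𝓡∂ 4) f 2).ncard = 1) ∧
          (∃ f : W₂ → ℝ, IsMorseAdapted (𝓡∂ 4) f ∧
            (∀ z, IsMCriticalPt (𝓡∂ 4) f z → morseIndex (𝓡∂ 4) f z ≤ 2) ∧
            (criticalSetOfIndex (𝓡∂ 4) f 0).ncard = 1 ∧ (criticalSetOfIndex (𝓡∂ 4) f 1).ncard = 1 ∧
            (criticalSetOfIndex (𝓡∂ 4) f 2).ncard = 1)) →
      Nonempty (X ≃ₘ⟮𝓡 4, 𝓡 4⟯ Metric.sphere (0 : EuclideanSpace ℝ (Fin 5)) 1) :=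
  fun h X _ _ _ _ _ _ W₁ _ _ _ _ _ W₂ _ _ _ _ _ J₁ J₂ e₁ e₂ h1 h2 hcov hL hR hC _ _ =>
    crux_of_spc4 h X W₁ W₂ J₁ J₂ e₁ e₂ h1 h2 hcov hL hR hC

end Summit.SmoothPoincare4.SmoothPoincare4.Theorems.ContractibleTwistedDoubleStandard.Negative

end
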